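import Literature.NumberTheory.Automorphic.Liu2021.Def411WeilCarriersDoubling     -- ★ `doubledWeilRep χ`, `isDoubledWeilRep_doubledWeilRep`
import Literature.NumberTheory.K2Lit.SiegelEisensteinSeriesDoubled                  -- ★ D2: `siegelDeltaCharacter`, `IsSiegelDeltaSection`
import HarnessLib

/-!
# K2Lit — Siegel–Weil sections on the DOUBLED unitary group attached to the trivial hermitian line (DEFS leaf O42.3a)

Topic `NumberTheory/K2Lit` (Track B, build stream 29; item of record hLiu418 = stmt-HodgeConjecture-24832; steward of socket #42R
`sig_K2LiuEisensteinResidueIsThetaIntegral`: `hodgecm-mathlib-K2Liu-p02` (g2), REPORT-FIRST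
`K2/K2Liu-p02/g2/REPORT-FIRST-42-EisensteinResidueIsThetaIntegral.K2Liup02g2.md` §3 organ O42.3, 2026-09-04).
Definitions and proved lemmas only: **no `sorry`, no named fact, no instance, no notation.**

The regularised Siegel–Weil formula [GanQiuTakeda2014, §7 Thm. 18, Thm. 20 (i)] compares the Siegel Eisenstein series of a
SIEGEL–WEIL SECTION `f_Φ(h) = (ω(h)Φ)(0)` with a theta integral.  The tree already holds the Weil representation of the doubled
group `H(𝔸) = U(𝕍 ⊕ −𝕍)(𝔸)` for the partner LINE `⟨1⟩`, normalised à la Kudla on the Siegel parabolic `P_Δ(𝔸)` — the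
interface Prop ★ `GRConstruction.IsDoubledWeilRep χ sD` (`sD : H(𝔸) →* Mp(𝕎^𝔻)ᶜᵒⁿᵗ`, PARABOLIC CLAUSE: the implementer
`r_F(δ)·sD(p)·r_F(δ)⁻¹` of `δι(p)δ⁻¹ ∈ P_𝕐(𝔸)` has value-at-the-origin scalar `χ(det_Δ p)·|det_Δ p|_{𝔸_L}^{1/2}`) and its
hypothesis-free witness ★ `Def411WeilCarriersDoubling.doubledWeilRep χ` — so the Siegel–Weil section of the trivial line needs NO
new Weil-representation data:

* `swSection χ sD Φ h := (ω(r_F(δ) · sD h) Φ)(0)` — the value at the origin of `Φ` transported by `sD h` and read in the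
  `Δ`-adapted model through Weil's rational operator `r_F(δ)` (★ `rDelta`);
* **`isSiegelDeltaSection_swSection`** — for `sD` with `IsDoubledWeilRep χ sD`, `swSection χ sD Φ` IS a Siegel section of
  `I(s₀, χ)` at `s₀ = (1 − n)/2` (★ `IsSiegelDeltaSection χ ((1 − n)/2)`): the parabolic clause gives the factor
  `χ(det_Δ p)·|det_Δ p|^{1/2} = χ(det_Δ p)·(|det_Δ p|^{1/2})^{2s₀+n}` of ★ `siegelDeltaCharacter χ s₀` exactly when `2s₀ + n = 1`.
  For the frame of hLiu418 (`n = 2`) this is `s₀ = −½`, the Siegel–Weil point of a LINE (`m = 1`) for `U(2,2)`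
  [GanQiuTakeda2014, §1.10 `s_{m,n} = (m − n)/2`; Liu2021 p. 104 `f_Φ^{(s_a)}`].
* `swSection_add ∕ _smul` (linearity in `Φ`), `swSectionChi` (the section at ★ `doubledWeilRep χ`).

Not here (sized in the steward's memo): the flat STANDARD extension `f_{Φ,s}` (needs an Iwasawa height on `H(𝔸)`, organ with ★
`IwasawaDatum`), `K`-finiteness of `swSection` for `K`-finite `Φ`, Siegel–Weil sections of hermitian 3-spaces (organ O42.4: the value of the
doubling-induced splitting ★ `chiSplitting` on `P_Δ`), and any Siegel–Weil identity (sockets).  HONEST LABEL: HC_CM is proved only modulo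
the 7 printed citations (2 remaining named inputs: hLiu418 = stmt-HodgeConjecture-24832, h413 = stmt-HodgeConjecture-24833) until rung 0
closes; this leaf asserts nothing printed.

References: [GanQiuTakeda2014] W. T. Gan, Y. Qiu, S. Takeda, Invent. Math. 198 (2014), §1.10, §7 Thm. 18 ∕ 20; [KudlaRallis1994] S. Kudla,
S. Rallis, Ann. of Math. 140 (1994) §1 (Siegel–Weil sections `Φ ↦ f_Φ`); [HarrisKudlaSweet1996] §1 (1.8), (1.14)–(1.15); [Kudla1994] S. Kudla,
Israel J. Math. 87, Thm. 3.1; [Liu2021] Y. Liu, Camb. J. Math. 9 (2021) App. B p. 104; [Ichino2004] A. Ichino, Math. Z. 247, §1.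
-/

set_option autoImplicit false
-- the doubled metaplectic carrier `Mp(𝕎^𝔻)ᶜᵒⁿᵗ` elaborates slowly (cf. ★ `ThetaLiftFromLineCentralCharacter`, 800 000 heartbeats for two rewrites)
set_option maxHeartbeats 2000000

noncomputable section

open NumberField IsDedekindDomain
open scoped Matrix

namespace Literature.NumberTheory.K2Lit.SiegelDoubled

open Literature.NumberTheory.Automorphic Literature.NumberTheory.GaloisRepresentations
open Literature.NumberTheory.GelbartRogawski1991 Literature.NumberTheory.GelbartRogawski1991.GRConstruction
open Literature.NumberTheory.Automorphic.Liu2021.Def411WeilCarriersDoubling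
open Literature.NumberTheory.Weil1964
open Literature.RepresentationTheory.HarrisKudlaSweet1996

variable (L : Type) [Field L] [NumberField L] [IsCMField L]
variable {N M n : ℕ} (e : Fin N × Fin M ≃ Fin n)
  (dV : Fin N → L) (hdV : ∀ i, IsCMField.complexConj L (dV i) = dV i) (hdV0 : ∀ i, dV i ≠ 0)
  (dW : Fin M → L) (hdW : ∀ i, IsCMField.complexConj L (dW i) = dW i) (hdW0 : ∀ i, dW i ≠ 0)

/-! ## 1. The Siegel–Weil section of a Schwartz–Bruhat function (partner line `⟨1⟩`) -/

/-- **The Siegel–Weil section `f_Φ(h) = (ω(r_F(δ)·sD(h))Φ)(0)`** attached to `Φ ∈ 𝒮(𝔸_{L⁺}^{n+n})` and a doubled Weil representation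
`sD : H(𝔸) →* Mp(𝕎^𝔻)ᶜᵒⁿᵗ` (meaningful for `IsDoubledWeilRep χ sD`; ★ `rDelta` reads the `Δ`-adapted model).
[cite: KudlaRallis1994, §1] [cite: HarrisKudlaSweet1996, §1 (1.8)] -/
def swSection (sD : HA L e dV hdV dW hdW →* MpD L e dV hdV dW hdW) (Φ : piSchwartzBruhat (Fp L) (Fin (n + n)))
    (h : HA L e dV hdV dW hdW) : ℂ :=
  opD L e dV hdV dW hdW (rDelta L e dV hdV hdV0 dW hdW hdW0 * sD h) Φ 0

/-- `Φ ↦ f_Φ(h)` is additive. [cite: KudlaRallis1994, §1] -/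
theorem swSection_add (sD : HA L e dV hdV dW hdW →* MpD L e dV hdV dW hdW) (Φ Ψ : piSchwartzBruhat (Fp L) (Fin (n + n)))
    (h : HA L e dV hdV dW hdW) :
    swSection L e dV hdV hdV0 dW hdW hdW0 sD (Φ + Ψ) h =
      swSection L e dV hdV hdV0 dW hdW hdW0 sD Φ h + swSection L e dV hdV hdV0 dW hdW hdW0 sD Ψ h := by
  exact congrArg (fun T : piSchwartzBruhat (Fp L) (Fin (n + n)) => (T : (Fin (n + n) → AdeleRing (𝓞 (Fp L)) (Fp L)) → ℂ) 0)
    ((adelicMpCont.omega (Fp L) (Fin (n + n)) (gramDA L e dV hdV dW hdW) (rDelta L e dV hdV hdV0 dW hdW hdW0 * sD h)).map_add Φ Ψ)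

/-- `Φ ↦ f_Φ(h)` is homogeneous. [cite: KudlaRallis1994, §1] -/
theorem swSection_smul (sD : HA L e dV hdV dW hdW →* MpD L e dV hdV dW hdW) (c : ℂ) (Φ : piSchwartzBruhat (Fp L) (Fin (n + n)))
    (h : HA L e dV hdV dW hdW) :
    swSection L e dV hdV hdV0 dW hdW hdW0 sD (c • Φ) h = c * swSection L e dV hdV hdV0 dW hdW hdW0 sD Φ h := by
  exact congrArg (fun T : piSchwartzBruhat (Fp L) (Fin (n + n)) => (T : (Fin (n + n) → AdeleRing (𝓞 (Fp L)) (Fp L)) → ℂ) 0)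
    ((adelicMpCont.omega (Fp L) (Fin (n + n)) (gramDA L e dV hdV dW hdW) (rDelta L e dV hdV hdV0 dW hdW hdW0 * sD h)).map_smul c Φ)

/-! ## 2. It is a Siegel section of `I((1 − n)/2, χ)` -/

/-- on `P_Δ(𝔸)` the character of ★ `siegelDeltaCharacter` at `s₀ = (1 − n)/2` is `χ(det_Δ p)·|det_Δ p|^{1/2}` (exponent `2s₀ + n = 1`).
[cite: GanQiuTakeda2014, §1.10] -/
theorem siegelDeltaCharacter_swPoint (χ : HeckeCharacter L) (p : HA L e dV hdV dW hdW) :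
    siegelDeltaCharacter L e dV hdV dW hdW χ ((1 - (n : ℂ)) / 2) p =
      ((chiDet L e dV hdV dW hdW χ p : ℂˣ) : ℂ) * (modDelta L e dV hdV dW hdW p : ℂ) := by
  have h1 : 2 * ((1 - (n : ℂ)) / 2) + (n : ℂ) = 1 := by ring
  have h2 : ((modDelta L e dV hdV dW hdW p : ℝ) : ℂ) ^ (2 * ((1 - (n : ℂ)) / 2) + (n : ℂ)) = (modDelta L e dV hdV dW hdW p : ℂ) := by
    rw [h1, Complex.cpow_one]
  simp only [siegelDeltaCharacter, h2]

include hdV0 hdW0 in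
/-- **THE SIEGEL–WEIL SECTION IS A SIEGEL SECTION OF `I((1 − n)/2, χ)`**: for a `χ`-normalised doubled Weil representation `sD`
(★ `IsDoubledWeilRep χ sD`), `f_Φ(p·h) = χ(det_Δ p)·|det_Δ p|^{1/2}·f_Φ(h)` for `p ∈ P_Δ(𝔸)` — the parabolic clause applied to the transported
function `ω(r_F(δ)·sD(h))Φ`.  For `n = 2` the point is `s₀ = −½`, the Siegel–Weil point of a line for `U(2,2)`.
[cite: KudlaRallis1994, §1] [cite: GanQiuTakeda2014, §1.10; §7 Thm. 18] [cite: Liu2021, App. B p. 104] -/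
theorem isSiegelDeltaSection_swSection {χ : HeckeCharacter L} {sD : HA L e dV hdV dW hdW →* MpD L e dV hdV dW hdW}
    (hsD : IsDoubledWeilRep L e dV hdV hdV0 dW hdW hdW0 χ sD) (Φ : piSchwartzBruhat (Fp L) (Fin (n + n))) :
    IsSiegelDeltaSection L e dV hdV dW hdW χ ((1 - (n : ℂ)) / 2) (swSection L e dV hdV hdV0 dW hdW hdW0 sD Φ) := by
  intro p hp h
  have hu := isUnit_detDelta_of_isSiegelDelta L e dV hdV dW hdW p hp
  -- `r(δ)·sD(p h) = (r(δ)·sD(p)·r(δ)⁻¹) · (r(δ)·sD(h))` (term-mode group algebra: no rewriting inside `Mp(𝕎^𝔻)ᶜᵒⁿᵗ`)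
  have hfac : rDelta L e dV hdV hdV0 dW hdW hdW0 * sD (p * h) =
      (rDelta L e dV hdV hdV0 dW hdW hdW0 * sD p * (rDelta L e dV hdV hdV0 dW hdW hdW0)⁻¹) *
        (rDelta L e dV hdV hdV0 dW hdW hdW0 * sD h) :=
    (congrArg (rDelta L e dV hdV hdV0 dW hdW hdW0 * ·) (sD.map_mul p h)).trans
      ((mul_assoc _ _ _).trans ((congrArg (rDelta L e dV hdV hdV0 dW hdW hdW0 * sD p * ·)
        (inv_mul_cancel_left (rDelta L e dV hdV hdV0 dW hdW hdW0) (sD h))).trans (mul_assoc _ _ _))).symm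
  -- `ω` is a representation: `ω(q·q′)Φ = ω(q)(ω(q′)Φ)`
  have hop : opD L e dV hdV dW hdW
        ((rDelta L e dV hdV hdV0 dW hdW hdW0 * sD p * (rDelta L e dV hdV hdV0 dW hdW hdW0)⁻¹) *
          (rDelta L e dV hdV hdV0 dW hdW hdW0 * sD h)) Φ =
      opD L e dV hdV dW hdW (rDelta L e dV hdV hdV0 dW hdW hdW0 * sD p * (rDelta L e dV hdV hdV0 dW hdW hdW0)⁻¹)
        (adelicMpCont.omega (Fp L) (Fin (n + n)) (gramDA L e dV hdV dW hdW) (rDelta L e dV hdV hdV0 dW hdW hdW0 * sD h) Φ) :=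
    congrArg (fun T : piSchwartzBruhat (Fp L) (Fin (n + n)) => ((T : (Fin (n + n) → AdeleRing (𝓞 (Fp L)) (Fp L)) → ℂ)))
      (LinearMap.congr_fun ((adelicMpCont.omega (Fp L) (Fin (n + n)) (gramDA L e dV hdV dW hdW)).map_mul _ _) Φ)
  show opD L e dV hdV dW hdW (rDelta L e dV hdV hdV0 dW hdW hdW0 * sD (p * h)) Φ 0 =
    siegelDeltaCharacter L e dV hdV dW hdW χ ((1 - (n : ℂ)) / 2) p *
      opD L e dV hdV dW hdW (rDelta L e dV hdV hdV0 dW hdW hdW0 * sD h) Φ 0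
  rw [hfac, hop]
  have H := hsD.parabolic p hp hu (adelicMpCont.omega (Fp L) (Fin (n + n)) (gramDA L e dV hdV dW hdW)
      (rDelta L e dV hdV hdV0 dW hdW hdW0 * sD h) Φ)
  exact H.trans (congrArg (fun c : ℂ => c * opD L e dV hdV dW hdW (rDelta L e dV hdV hdV0 dW hdW hdW0 * sD h) Φ 0)
    (siegelDeltaCharacter_swPoint L e dV hdV dW hdW χ p)).symm

/-! ## 3. The section attached to `χ` -/

/-- **`f_Φ^χ`**: the Siegel–Weil section for the doubled Weil representation ATTACHED TO `χ` (★ `doubledWeilRep χ`, unitary `χ` with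
`χ|_{𝕀_{L⁺}} = ε_{L/L⁺}`). [cite: HarrisKudlaSweet1996, §1 (1.14)–(1.15)] [cite: KudlaRallis1994, §1] -/
def swSectionChi (χ : HeckeCharacter L) (hχu : χ.IsUnitary) (hχs : IsSplittingChar L 1 χ)
    (Φ : piSchwartzBruhat (Fp L) (Fin (n + n))) : HA L e dV hdV dW hdW → ℂ :=
  swSection L e dV hdV hdV0 dW hdW hdW0 (doubledWeilRep L e dV hdV hdV0 dW hdW hdW0 χ hχu hχs) Φ

/-- `f_Φ^χ ∈ I((1 − n)/2, χ)`. [cite: KudlaRallis1994, §1] [cite: GanQiuTakeda2014, §7 Thm. 18] -/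
theorem isSiegelDeltaSection_swSectionChi (χ : HeckeCharacter L) (hχu : χ.IsUnitary) (hχs : IsSplittingChar L 1 χ)
    (Φ : piSchwartzBruhat (Fp L) (Fin (n + n))) :
    IsSiegelDeltaSection L e dV hdV dW hdW χ ((1 - (n : ℂ)) / 2) (swSectionChi L e dV hdV hdV0 dW hdW hdW0 χ hχu hχs Φ) :=
  isSiegelDeltaSection_swSection L e dV hdV hdV0 dW hdW hdW0 (isDoubledWeilRep_doubledWeilRep L e dV hdV hdV0 dW hdW hdW0 χ hχu hχs) Φ

end Literature.NumberTheory.K2Lit.SiegelDoubled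

end
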